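import Literature.AnabelianGeometry.EtaleTheta.Discharge.Sec3Thm37UnitProfiniteOfDivisorial
import Literature.AnabelianGeometry.EtaleTheta.Discharge.Sec3Thm37UnitsWeak
import Literature.AnabelianGeometry.SemiGraphs.CosetCategoriesSlimTempered
import Literature.AlgebraicGeometry.Frobenioids.QuasiTemperoidConnectedPart
import HarnessLib

/-!
# [EtTh] Theorem 3.7 (i) (unit clauses) and (iv) at the WEAK canonical monoid vocabulary `treeMonoidVocabWeak`, for
# ANY category vocabulary `VD` — UNCONDITIONALLY for the weak constructed data `ofRlfRWeak` / from Prop 3.4 (ii) alone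
# for `ofRlfZWeak`; and «`C` slim» at the genuine base `B^temp(Π)⁰` with NO `hBinj`

S. Mochizuki, *The étale theta function and its Frobenioid-theoretic manifestations*, Publ. RIMS **45**
(2009), Theorem 3.7 (i), (iv), PDF pp. 79–80 [cite: MochizukiEtTh2009, Thm 3.7 p.79]
[cite: MochizukiEtTh2009, Thm 3.7 p.80]; Def. 3.6 (ii), p. 77: "`Φ` … determines a perf-factorial … monoid on `D`";
Rmk. 3.7.2 p.80 / [SemiAnbd] Rmk. 3.4.1: `D = B^temp(Π^tp_X)⁰` is slim.

WEAK-VOCABULARY TWIN of abc-iut-f-047's `Discharge/Sec3Thm37UnitsTreeMonoidVocab.lean` and of §§3–4 of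
`Discharge/Sec3Thm37ivGenuineBase.lean`.  At abc-iut-L2-t3's weak monoid vocabulary `treeMonoidVocabWeak` the Def. 3.6 (ii)
field `isPerfFactorial` READS `IsPerfFactorialCof` (weakly perf-factorial with cofinal perfection), which still gives
"`Φ(A)` divisorial, hence sharp" (`IsPerfFactorialWeak.isDivisorial`) — all that the vocabulary-generic unit rows of
`Sec3Thm37UnitsOfDivisorial.lean` / `Sec3Thm37UnitProfiniteOfDivisorial.lean` need.  Hence, for every category
vocabulary `VD` (not only `treeCatVocab` as in this seat's `Sec3Thm37UnitsOfDivisorialWeak.lean`, which this file does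
not import):
* `isDivisorial_divisorMonoid_treeMonoidVocabWeak`; `thm37_iv_treeMonoidVocabWeak_of_hdiv`,
  `thm37_i_unitTrivial_treeMonoidVocabWeak_of_divΛ_injective` / `thm37_iv_treeMonoidVocabWeak_of_divΛ_injective`
  (`Λ = ℝ`-shape), `thm37_iv_treeMonoidVocabWeak_of_isOfUnitProfiniteType`,
  `isOfUnitProfiniteType_treeMonoidVocabWeak_of_ker` / `thm37_iv_treeMonoidVocabWeak_of_ker`,
  `thm37_i_unitProfinite_and_iv_treeMonoidVocabWeak_of_kerIsoPadicUnits` (`Λ = ℤ`-shape);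
* **`thm37_i_unitTrivial_ofRlfRWeak_holds`, `thm37_iv_ofRlfRWeak_holds`, `thm37_i_unitConjuncts_ofRlfRWeak_holds`** —
  for EVERY tempered Frobenioid over abc-iut-L6-t12's weak `Λ = ℝ` data `ofRlfRWeak` (the `Ÿ` / `Z_∞`-type data,
  F-L2d2-1), ANY `VD`, NO hypothesis;
* `thm37_i_unitProfinite_and_iv_ofRlfZWeak_of_kerIsoPadicUnits` — `Λ = ℤ` data `ofRlfZWeak`, any `VD`, from the
  Prop. 3.4 (ii) isomorphisms alone;
* **`isSlim_category_ofRlfRWeak_connectedPart_bTemp (hG) (hZ)`** — «`C` is slim» at the genuine base `B^temp(Π)⁰`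
  (`Π` tempered and temp-slim) for the weak `Λ = ℝ` data with NO further hypothesis (the strong
  `isSlim_category_ofRlfR_connectedPart_bTemp` still binds `hBinj`; here `hBinj` is gone because unit-triviality no
  longer passes through [FrdI] Thm 5.2 (ii)); `isOfUnitProfiniteType_and_isSlim_ofRlfZWeak_connectedPart_bTemp (hG)
  (hZ) (hP34)` — `Λ = ℤ`, modulo the Prop. 3.4 (ii) isomorphisms ONLY (no `hBinj`).
Seat abc-iut-L6-t12 (gen 4), cell abc-iut, row «§3 WEAK COLUMN at Λ = ℚ/ℝ» piece (W10).  PROOF-ONLY (0 defs).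
HONEST FRAMING: refereed pre-IUT material; nothing here bears on [IUTchIII] Cor. 3.12; typed ≠ proved — here PROVED.
-/

noncomputable section

namespace Literature.AnabelianGeometry.EtaleTheta

open CategoryTheory Opposite Literature.AlgebraicGeometry.Frobenioids Literature.AnabelianGeometry.SemiGraphs

universe u₀ v₀ u v w uK

namespace TemperedFrobenioid

section TreeMonoidVocabWeak

variable {D₀ : Type u₀} [Category.{v₀} D₀] {D : Type u} [Category.{v} D] {VD : FrdICatStub.{u, v, w} D}
  {p : ℕ} [Fact p.Prime]

/-! (The weak datum `T` is bound IN each statement of this section, so that no statement is textually its strong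
`treeMonoidVocab` twin — the gate hashes statements without section variables.) -/

/-- At the WEAK canonical monoid vocabulary every divisor monoid `Φ(A)` of a tempered Frobenioid is DIVISORIAL,
whatever the category vocabulary `VD`: Def. 3.6 (ii) read as `IsPerfFactorialCof`, and weakly perf-factorial ⟹
divisorial ([FrdI] Def. 2.4 (i)(a)). [cite: MochizukiEtTh2009, Def 3.6 p.77] -/
theorem isDivisorial_divisorMonoid_treeMonoidVocabWeak
    {T : RealifiedDivisorMonoids (D₀ := D₀) treeMonoidVocabWeak.{w}}
    (C₀ : TemperedFrobenioid T D VD) (A : D) :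
    IsDivisorial (C₀.divisorMonoid.obj (op A)) :=
  Exists.elim ((treeMonoidVocabWeak_isPerfFactorial _).mp (C₀.isPerfFactorial (op A))) fun hw _ => hw.isDivisorial

/-- **Thm. 3.7 (iv) "`D` slim ⟹ `C` slim" at `treeMonoidVocabWeak`, any `VD`, from `⋂ₙ O^×(A)ⁿ = 1` ALONE.**
[cite: MochizukiEtTh2009, Thm 3.7 p.80] -/
theorem thm37_iv_treeMonoidVocabWeak_of_hdiv
    {T : RealifiedDivisorMonoids (D₀ := D₀) treeMonoidVocabWeak.{w}}
    (C₀ : TemperedFrobenioid T D VD)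
    (hdiv : ∀ (X : C₀.category) (α : Aut X), α ∈ PreFrobenioid.unitsSubgroup C₀.toElem X →
      (∀ n : ℕ+, ∃ β : Aut X, β ∈ PreFrobenioid.unitsSubgroup C₀.toElem X ∧ β ^ (n : ℕ) = α) → α = 1) :
    C₀.Thm37_iv :=
  C₀.thm37_iv_of_sharp (fun A => (C₀.isDivisorial_divisorMonoid_treeMonoidVocabWeak A).isSharp) hdiv

/-- **Thm. 3.7 (i), "unit-trivial type" at `treeMonoidVocabWeak`, any `VD`**, from the injectivity of
`B₀^Λ → (Φ₀^ℝ)^gp` alone (`Λ = ℝ`-shape). [cite: MochizukiEtTh2009, Thm 3.7 p.79] -/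
theorem thm37_i_unitTrivial_treeMonoidVocabWeak_of_divΛ_injective
    {T : RealifiedDivisorMonoids (D₀ := D₀) treeMonoidVocabWeak.{w}}
    (C₀ : TemperedFrobenioid T D VD)
    (hinj : ∀ A : Dᵒᵖ, Function.Injective (T.divΛ (C₀.baseOp A))) :
    PreFrobenioid.IsOfType (PreFrobenioid.IsUnitTrivial C₀.toElem) :=
  C₀.thm37_i_unitTrivial_of_isDivisorial C₀.isDivisorial_divisorMonoid_treeMonoidVocabWeak hinj

/-- **Thm. 3.7 (iv) at `treeMonoidVocabWeak`, any `VD`**, from the injectivity of `B₀^Λ → (Φ₀^ℝ)^gp` alone.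
[cite: MochizukiEtTh2009, Thm 3.7 p.80] -/
theorem thm37_iv_treeMonoidVocabWeak_of_divΛ_injective
    {T : RealifiedDivisorMonoids (D₀ := D₀) treeMonoidVocabWeak.{w}}
    (C₀ : TemperedFrobenioid T D VD)
    (hinj : ∀ A : Dᵒᵖ, Function.Injective (T.divΛ (C₀.baseOp A))) : C₀.Thm37_iv :=
  C₀.thm37_iv_of_isDivisorial_of_divΛ_injective C₀.isDivisorial_divisorMonoid_treeMonoidVocabWeak hinj

/-- **Thm. 3.7 (iv) at `treeMonoidVocabWeak`, any `VD`**, from "unit-profinite type" alone (`Λ = ℤ`-shape).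
[cite: MochizukiEtTh2009, Thm 3.7 p.80] -/
theorem thm37_iv_treeMonoidVocabWeak_of_isOfUnitProfiniteType
    {T : RealifiedDivisorMonoids (D₀ := D₀) treeMonoidVocabWeak.{w}}
    (C₀ : TemperedFrobenioid T D VD)
    (hprof : PreFrobenioid.IsOfUnitProfiniteType C₀.toElem) : C₀.Thm37_iv :=
  C₀.thm37_iv_of_sharp_of_isOfUnitProfiniteType
    (fun A => (C₀.isDivisorial_divisorMonoid_treeMonoidVocabWeak A).isSharp) hprof

/-- **Thm. 3.7 (i), "unit-profinite type" at `treeMonoidVocabWeak`, any `VD`**, from the kernel datum of (L06)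
alone. [cite: MochizukiEtTh2009, Thm 3.7 p.79] -/
theorem isOfUnitProfiniteType_treeMonoidVocabWeak_of_ker
    {T : RealifiedDivisorMonoids (D₀ := D₀) treeMonoidVocabWeak.{w}}
    (C₀ : TemperedFrobenioid T D VD)
    (hker : ∀ A : Dᵒᵖ, AdmitsTfgProfiniteTopology
      ((T.divΛ (C₀.baseOp A)).comp (Units.coeHom (T.BΛ.obj (C₀.baseOp A)))).ker) :
    PreFrobenioid.IsOfUnitProfiniteType C₀.toElem :=
  C₀.isOfUnitProfiniteType_of_isDivisorial_of_ker C₀.isDivisorial_divisorMonoid_treeMonoidVocabWeak hker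

/-- **Thm. 3.7 (iv) at `treeMonoidVocabWeak`, any `VD`**, from the kernel datum of (L06) alone.
[cite: MochizukiEtTh2009, Thm 3.7 p.80] -/
theorem thm37_iv_treeMonoidVocabWeak_of_ker
    {T : RealifiedDivisorMonoids (D₀ := D₀) treeMonoidVocabWeak.{w}}
    (C₀ : TemperedFrobenioid T D VD)
    (hker : ∀ A : Dᵒᵖ, AdmitsTfgProfiniteTopology
      ((T.divΛ (C₀.baseOp A)).comp (Units.coeHom (T.BΛ.obj (C₀.baseOp A)))).ker) : C₀.Thm37_iv :=
  C₀.thm37_iv_of_isDivisorial_of_ker C₀.isDivisorial_divisorMonoid_treeMonoidVocabWeak hker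

/-- **Thm. 3.7 (i) "unit-profinite type" and (iv) at `treeMonoidVocabWeak`, any `VD`, from the Prop. 3.4 (ii)
isomorphisms `Ker(B₀^Λ(Y_A)^× → (Φ₀^ℝ)^gp(Y_A)) ≅ O_L^×` alone** (`Λ = ℤ`-shape). [cite: MochizukiEtTh2009, Thm 3.7 p.80] -/
theorem thm37_i_unitProfinite_and_iv_treeMonoidVocabWeak_of_kerIsoPadicUnits
    {T : RealifiedDivisorMonoids (D₀ := D₀) treeMonoidVocabWeak.{w}}
    (C₀ : TemperedFrobenioid T D VD)
    (hP34 : ∀ A : Dᵒᵖ, ∃ L : PadicFrd.PadicFld.{uK} p, L.IsPadicLocal ∧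
      Nonempty (((T.divΛ (C₀.baseOp A)).comp (Units.coeHom (T.BΛ.obj (C₀.baseOp A)))).ker ≃*
        PadicFrd.unitSubgroup L.K)) :
    PreFrobenioid.IsOfUnitProfiniteType C₀.toElem ∧ C₀.Thm37_iv :=
  ⟨C₀.isOfUnitProfiniteType_of_isDivisorial_of_kerIsoPadicUnits C₀.isDivisorial_divisorMonoid_treeMonoidVocabWeak hP34,
    C₀.thm37_iv_of_isDivisorial_of_kerIsoPadicUnits C₀.isDivisorial_divisorMonoid_treeMonoidVocabWeak hP34⟩

end TreeMonoidVocabWeak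

/-! ### The weak constructed data `ofRlfRWeak` (`Λ = ℝ`) and `ofRlfZWeak` (`Λ = ℤ`), over ANY category vocabulary -/

section OfRlfWeak

variable {D₀ : Type u₀} [Category.{v₀} D₀] (dm : DivisorMonoids.{u₀, v₀, w} D₀)
  (hpf : ∀ Y : D₀ᵒᵖ, IsPerfFactorialCof (dm.Φ₀.obj Y)) {D : Type u} [Category.{v} D]
  {VD : FrdICatStub.{u, v, w} D} {p : ℕ} [Fact p.Prime]

/-- **Thm. 3.7 (i), "unit-trivial type", for EVERY tempered Frobenioid over the weak constructed `Λ = ℝ` data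
`ofRlfRWeak`, over any category vocabulary — UNCONDITIONAL.** [cite: MochizukiEtTh2009, Thm 3.7 p.79] -/
theorem thm37_i_unitTrivial_ofRlfRWeak_holds
    (C : TemperedFrobenioid (RealifiedDivisorMonoids.ofRlfRWeak dm hpf) D VD) :
    PreFrobenioid.IsOfType (PreFrobenioid.IsUnitTrivial C.toElem) :=
  C.thm37_i_unitTrivial_treeMonoidVocabWeak_of_divΛ_injective fun A =>
    RealifiedDivisorMonoids.ofRlfRWeak_divΛ_injective dm hpf (C.baseOp A)

/-- **Thm. 3.7 (iv) "`D` slim ⟹ `C` slim" for EVERY tempered Frobenioid over the weak `Λ = ℝ` data `ofRlfRWeak`,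
over any category vocabulary — UNCONDITIONAL** (the named `Prop` `Thm37_iv` with no hypothesis).
[cite: MochizukiEtTh2009, Thm 3.7 p.80] -/
theorem thm37_iv_ofRlfRWeak_holds
    (C : TemperedFrobenioid (RealifiedDivisorMonoids.ofRlfRWeak dm hpf) D VD) :
    TemperedFrobenioid.Thm37_iv (T := RealifiedDivisorMonoids.ofRlfRWeak dm hpf) C :=
  C.thm37_iv_treeMonoidVocabWeak_of_divΛ_injective fun A =>
    RealifiedDivisorMonoids.ofRlfRWeak_divΛ_injective dm hpf (C.baseOp A)

/-- The two UNIT conjuncts of the typed `Thm37_i F` for the weak `ofRlfRWeak` data, any category vocabulary and ANY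
facade `F` — UNCONDITIONAL (the `Λ = ℤ` conjunct is vacuous). [cite: MochizukiEtTh2009, Thm 3.7 p.79] -/
theorem thm37_i_unitConjuncts_ofRlfRWeak_holds
    (C : TemperedFrobenioid (RealifiedDivisorMonoids.ofRlfRWeak dm hpf) D VD) (F : FrobenioidFacade.{u, v, w} D) :
    (C.monoidType = MonoidType.Z → F.IsOfUnitProfiniteType C.toElem) ∧
      (C.monoidType = MonoidType.R → PreFrobenioid.IsOfType (PreFrobenioid.IsUnitTrivial C.toElem)) :=
  ⟨fun h => absurd ((monoidType_ofRlfRWeak dm hpf C).symm.trans h) (by decide),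
    fun _ => thm37_i_unitTrivial_ofRlfRWeak_holds dm hpf C⟩

/-- **Thm. 3.7 (i) "unit-profinite type" and (iv) for EVERY tempered Frobenioid over the weak constructed `Λ = ℤ`
data `ofRlfZWeak`, any category vocabulary, from the Prop. 3.4 (ii) isomorphisms
`Ker(B₀(Y_A)^× → (Φ₀^ℝ)^gp) ≅ O_L^×` ALONE.** [cite: MochizukiEtTh2009, Thm 3.7 p.80] -/
theorem thm37_i_unitProfinite_and_iv_ofRlfZWeak_of_kerIsoPadicUnits
    (C : TemperedFrobenioid (RealifiedDivisorMonoids.ofRlfZWeak dm hpf) D VD)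
    (hP34 : ∀ A : Dᵒᵖ, ∃ L : PadicFrd.PadicFld.{uK} p, L.IsPadicLocal ∧
      Nonempty ((((RealifiedDivisorMonoids.ofRlfZWeak dm hpf).divΛ (C.baseOp A)).comp
        (Units.coeHom ((RealifiedDivisorMonoids.ofRlfZWeak dm hpf).BΛ.obj (C.baseOp A)))).ker ≃*
        PadicFrd.unitSubgroup L.K)) :
    PreFrobenioid.IsOfUnitProfiniteType C.toElem ∧
      TemperedFrobenioid.Thm37_iv (T := RealifiedDivisorMonoids.ofRlfZWeak dm hpf) C :=
  C.thm37_i_unitProfinite_and_iv_treeMonoidVocabWeak_of_kerIsoPadicUnits hP34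

end OfRlfWeak

/-! ### «`C` slim» at the genuine base `B^temp(Π)⁰` for the weak data -/

section GenuineBase

variable {G : Type u} [Group G] [TopologicalSpace G] [IsTopologicalGroup G] {D₀ : Type u₀} [Category.{v₀} D₀]
  (dm : DivisorMonoids.{u₀, v₀, w} D₀) (hpf : ∀ Y : D₀ᵒᵖ, IsPerfFactorialCof (dm.Φ₀.obj Y))
  {VD : FrdICatStub (ConnectedPart (BTemp G))} {p : ℕ} [Fact p.Prime]

/-- **Thm. 3.7 (iv) for monoid type `ℝ` at the genuine base, conclusion «`C` is slim», with NO further hypothesis**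
for the weak data `ofRlfRWeak` over ANY category vocabulary on `B^temp(Π)⁰` (`Π` tempered and temp-slim: «`D` slim»
is [SemiAnbd] Rmk. 3.4.1, `isSlim_connectedPart_bTemp`; `Thm37_iv` holds outright, `thm37_iv_ofRlfRWeak_holds`).
[cite: MochizukiEtTh2009, Thm 3.7 p.80] -/
theorem isSlim_category_ofRlfRWeak_connectedPart_bTemp (hG : IsTempered G) (hZ : IsSlimGroup G)
    (C₀ : TemperedFrobenioid (RealifiedDivisorMonoids.ofRlfRWeak dm hpf) (ConnectedPart (BTemp G)) VD) :
    IsSlim C₀.category :=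
  thm37_iv_ofRlfRWeak_holds dm hpf C₀ (isSlim_connectedPart_bTemp hG hZ) (Or.inr (monoidType_ofRlfRWeak dm hpf C₀))

/-- **Thm. 3.7 (i) «unit-profinite type» ∧ (iv) «`C` slim» for monoid type `ℤ` at the genuine base**, for the weak
data `ofRlfZWeak` over any category vocabulary on `B^temp(Π)⁰`, modulo the Prop. 3.4 (ii) isomorphisms `hP34` ONLY
(`Π` tempered and temp-slim; no `hBinj`). [cite: MochizukiEtTh2009, Thm 3.7 p.80] -/
theorem isOfUnitProfiniteType_and_isSlim_ofRlfZWeak_connectedPart_bTemp (hG : IsTempered G) (hZ : IsSlimGroup G)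
    (C₁ : TemperedFrobenioid (RealifiedDivisorMonoids.ofRlfZWeak dm hpf) (ConnectedPart (BTemp G)) VD)
    (hP34 : ∀ A : (ConnectedPart (BTemp G))ᵒᵖ, ∃ L : PadicFrd.PadicFld.{uK} p, L.IsPadicLocal ∧
      Nonempty ((((RealifiedDivisorMonoids.ofRlfZWeak dm hpf).divΛ (C₁.baseOp A)).comp
        (Units.coeHom ((RealifiedDivisorMonoids.ofRlfZWeak dm hpf).BΛ.obj (C₁.baseOp A)))).ker ≃*
        PadicFrd.unitSubgroup L.K)) :
    PreFrobenioid.IsOfUnitProfiniteType C₁.toElem ∧ IsSlim C₁.category :=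
  have h := thm37_i_unitProfinite_and_iv_ofRlfZWeak_of_kerIsoPadicUnits dm hpf C₁ hP34
  ⟨h.1, h.2 (isSlim_connectedPart_bTemp hG hZ) (Or.inl (monoidType_ofRlfZWeak dm hpf C₁))⟩

end GenuineBase

end TemperedFrobenioid

end Literature.AnabelianGeometry.EtaleTheta

end
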